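import Mathlib.Analysis.Normed.Module.Ball.Pointwise
import Mathlib.Topology.Algebra.GroupWithZero
import Literature.Probability.Percolation.Crossings
import Literature.Probability.Percolation.QuadCrossingSpaceZ2

/-!
# Stub `stub_scalingIdentity` of line `registered` (crux `PolyominoGaussianLaw`,
# stmt-CriticalPhenomena-14337): exact scale covariance of the discretised crossing probability

For a dilation `T z = t z` of the plane with `t > 0`, the discretisation of the conformal
rectangle `(t·Ω; t·A, t·B)` at mesh `t δ` and the discretisation of `(Ω; A, B)` at mesh `δ`
(`Literature/Probability/LatticeModels/DomainDiscretisation.lean`) are *literally the same*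
subsets of `ℤ²`: the mesh points satisfy `meshPoint (t δ) x = T (meshPoint δ x)`, and every
ingredient of the construction (membership in the domain, closed segments in the closure, largest
connected component, vertex boundary, comparison of distances to a boundary arc and to the rest of
the frontier) is transported by the injective, ℝ-linear homeomorphism `T`, which scales all
distances by the common factor `t`. Consequently the crossing events
`discreteCrossing (T '' Ω) (t δ) (T '' A) (T '' B)` and `discreteCrossing Ω δ A B`
(`Literature/Probability/Percolation/Crossings.lean`) coincide as sets of bond configurations,
and so do their `P_{1/2}`-probabilities `discreteCrossingProb half`.

Main result: `stub_scalingIdentity`. The intermediate identities (`meshVertices_dilate`,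
`meshGraph_dilate`, `meshDomain_dilate`, `discreteDomainGraph_dilate`, `meshBoundary_dilate`,
`discreteArc_dilate`, `discreteCrossing_dilate`) are recorded as well; no sign assumption on the
mesh `δ` is needed anywhere. Reused from the tree: `meshPoint_mul`
(`QuadCrossingSpaceZ2.lean`) and `image_mul_left_segment`
(`QuadCrossingRotationInvarianceProofs.lean`).
-/

noncomputable section

namespace Summit.CriticalPhenomena.CardyFormulaZ2.Cruxes.PolyominoGaussianLaw.Birth

open Literature.Probability.LatticeModels Literature.Probability.Percolation

/-! ### Transport of the planar data under the dilation `z ↦ t z` -/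

/-- A positive real number is a nonzero complex number. [folklore] -/
private theorem ofReal_ne_zero_of_pos {t : ℝ} (ht : 0 < t) : (t : ℂ) ≠ 0 :=
  Complex.ofReal_ne_zero.2 ht.ne'

/-- The dilation `z ↦ t z`, `t ≠ 0`, commutes with closure. [folklore] -/
private theorem closure_image_mul {t : ℝ} (ht : 0 < t) (Ω : Set ℂ) :
    closure ((fun z : ℂ => (t : ℂ) * z) '' Ω) = (fun z : ℂ => (t : ℂ) * z) '' closure Ω :=
  ((Homeomorph.mulLeft₀ (t : ℂ) (ofReal_ne_zero_of_pos ht)).image_closure Ω).symm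

/-- The dilation `z ↦ t z`, `t ≠ 0`, commutes with the frontier. [folklore] -/
private theorem frontier_image_mul {t : ℝ} (ht : 0 < t) (Ω : Set ℂ) :
    frontier ((fun z : ℂ => (t : ℂ) * z) '' Ω) = (fun z : ℂ => (t : ℂ) * z) '' frontier Ω :=
  ((Homeomorph.mulLeft₀ (t : ℂ) (ofReal_ne_zero_of_pos ht)).image_frontier Ω).symm

/-- The dilation `z ↦ t z`, `t > 0`, multiplies the distance to a set by `t`. [folklore] -/
private theorem infDist_mul {t : ℝ} (ht : 0 < t) (p : ℂ) (s : Set ℂ) :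
    Metric.infDist ((t : ℂ) * p) ((fun z : ℂ => (t : ℂ) * z) '' s) = t * Metric.infDist p s := by
  have h := infDist_smul₀ (ofReal_ne_zero_of_pos ht) s p
  rw [Complex.norm_of_nonneg ht.le] at h
  simpa only [smul_eq_mul, ← Set.image_smul] using h

/-! ### The discretisation is scale covariant -/

/-- Same mesh vertices: `x ∈ (tΩ)_{tδ}`-candidates iff `x ∈ Ω_δ`-candidates. [folklore] -/
theorem meshVertices_dilate (Ω : Set ℂ) (δ : ℝ) {t : ℝ} (ht : 0 < t) :
    meshVertices ((fun z : ℂ => (t : ℂ) * z) '' Ω) (t * δ) = meshVertices Ω δ := by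
  ext x
  rw [mem_meshVertices_iff, mem_meshVertices_iff, meshPoint_mul]
  exact (mul_right_injective₀ (ofReal_ne_zero_of_pos ht)).mem_set_image

/-- Same mesh graph. [folklore] -/
theorem meshGraph_dilate (Ω : Set ℂ) (δ : ℝ) {t : ℝ} (ht : 0 < t) :
    meshGraph ((fun z : ℂ => (t : ℂ) * z) '' Ω) (t * δ) = meshGraph Ω δ := by
  ext x y
  simp only [meshGraph_adj_iff, meshPoint_mul, ← image_mul_left_segment, closure_image_mul ht,
    Set.image_subset_image_iff (mul_right_injective₀ (ofReal_ne_zero_of_pos ht))]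

/-- `meshDomain Ω δ` depends on `(Ω, δ)` only through the mesh vertices and the mesh graph.
[folklore] -/
private theorem meshDomain_congr {Ω Ω' : Set ℂ} {δ δ' : ℝ}
    (hV : meshVertices Ω δ = meshVertices Ω' δ') (hG : meshGraph Ω δ = meshGraph Ω' δ') :
    meshDomain Ω δ = meshDomain Ω' δ' := by
  have key : ∀ (V V' : Set (Site 2)) (G G' : SimpleGraph (Site 2)), V = V' → G = G' →
      (⋃ (C : (G.induce V).ConnectedComponent)
        (_ : ∀ C' : (G.induce V).ConnectedComponent, C'.supp.ncard ≤ C.supp.ncard),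
        Subtype.val '' C.supp : Set (Site 2)) =
      ⋃ (C : (G'.induce V').ConnectedComponent)
        (_ : ∀ C' : (G'.induce V').ConnectedComponent, C'.supp.ncard ≤ C.supp.ncard),
        Subtype.val '' C.supp := by
    rintro _ _ _ _ rfl rfl
    rfl
  exact key _ _ _ _ hV hG

/-- Same discrete domain (largest connected component). [folklore] -/
theorem meshDomain_dilate (Ω : Set ℂ) (δ : ℝ) {t : ℝ} (ht : 0 < t) :
    meshDomain ((fun z : ℂ => (t : ℂ) * z) '' Ω) (t * δ) = meshDomain Ω δ :=
  meshDomain_congr (meshVertices_dilate Ω δ ht) (meshGraph_dilate Ω δ ht)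

/-- Same graph `Ω_δ`. [folklore] -/
theorem discreteDomainGraph_dilate (Ω : Set ℂ) (δ : ℝ) {t : ℝ} (ht : 0 < t) :
    discreteDomainGraph ((fun z : ℂ => (t : ℂ) * z) '' Ω) (t * δ) = discreteDomainGraph Ω δ := by
  ext x y
  simp only [discreteDomainGraph_adj_iff, meshGraph_dilate Ω δ ht, meshDomain_dilate Ω δ ht]

/-- Same discrete boundary. [folklore] -/
theorem meshBoundary_dilate (Ω : Set ℂ) (δ : ℝ) {t : ℝ} (ht : 0 < t) :
    meshBoundary ((fun z : ℂ => (t : ℂ) * z) '' Ω) (t * δ) = meshBoundary Ω δ := by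
  ext x
  simp only [mem_meshBoundary_iff, meshDomain_dilate Ω δ ht, discreteDomainGraph_dilate Ω δ ht]

/-- Same discrete arcs: the comparison `dist(·, A) ≤ dist(·, ∂Ω ∖ A)` is scaled by the common
positive factor `t`. [folklore] -/
theorem discreteArc_dilate (Ω : Set ℂ) (δ : ℝ) (A : Set ℂ) {t : ℝ} (ht : 0 < t) :
    discreteArc ((fun z : ℂ => (t : ℂ) * z) '' Ω) (t * δ) ((fun z : ℂ => (t : ℂ) * z) '' A) =
      discreteArc Ω δ A := by
  ext x
  simp only [mem_discreteArc_iff, meshBoundary_dilate Ω δ ht, meshPoint_mul,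
    frontier_image_mul ht, ← Set.image_sdiff (mul_right_injective₀ (ofReal_ne_zero_of_pos ht)),
    infDist_mul ht, mul_le_mul_iff_right₀ ht]

/-- Same crossing event `C_δ(Ω; A, B)` as a set of bond configurations. [folklore] -/
theorem discreteCrossing_dilate (Ω : Set ℂ) (δ : ℝ) (A B : Set ℂ) {t : ℝ} (ht : 0 < t) :
    discreteCrossing ((fun z : ℂ => (t : ℂ) * z) '' Ω) (t * δ) ((fun z : ℂ => (t : ℂ) * z) '' A)
        ((fun z : ℂ => (t : ℂ) * z) '' B) =
      discreteCrossing Ω δ A B := by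
  ext ω
  simp only [mem_discreteCrossing_iff, discreteArc_dilate Ω δ _ ht,
    discreteDomainGraph_dilate Ω δ ht]

/-- stub 4 (exact scale covariance of the discretisation). For `t > 0` the discretisation of
`(t·Ω; t·A, t·B)` at mesh `t δ` and of `(Ω; A, B)` at mesh `δ` have the same mesh vertices, mesh
graph, largest component, discrete boundary and discrete arcs (as subsets of `ℤ²`), hence the same
`P_{1/2}` crossing probability. [folklore] -/
theorem stub_scalingIdentity :
    ∀ (Ω A B : Set ℂ) (δ t : ℝ), 0 < t →
      Literature.Probability.Percolation.discreteCrossingProb Literature.Probability.Percolation.half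
          ((fun z : ℂ => (t : ℂ) * z) '' Ω) (t * δ) ((fun z : ℂ => (t : ℂ) * z) '' A)
          ((fun z : ℂ => (t : ℂ) * z) '' B) =
        Literature.Probability.Percolation.discreteCrossingProb Literature.Probability.Percolation.half Ω δ A B := by
  intro Ω A B δ t ht
  unfold discreteCrossingProb
  rw [discreteCrossing_dilate Ω δ A B ht]

end Summit.CriticalPhenomena.CardyFormulaZ2.Cruxes.PolyominoGaussianLaw.Birth

end
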